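import Summits.Ventures.HodgeRepro2.T5SU11WendelGammaRatio
import Summits.Ventures.HodgeRepro2.T5SU11JacobiContinuity
import Summits.Ventures.HodgeRepro2.T5SU11CoeffSphericalTransform

/-!
# The Jacobi transform for large weight: `k · m̂_k(λ) → 2π`, differentiability in the weight

With the symmetric closed form `m̂_k(λ) = π Γ((k−λ)/2) Γ((k+λ)/2 − 1)/Γ(k/2)²` (`T5SU11JacobiDuplication`)
and the Gamma-ratio asymptotic `Γ(x+s) Γ(x+t)/(x^{s+t} Γ(x)²) → 1` (`T5SU11WendelGammaRatio`) at
`x = k/2`, `s = −λ/2`, `t = λ/2 − 1` (`s + t = −1`):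

* **`k · m̂_k(λ) → 2π` as `k → ∞`**, for every `λ` (`tendsto_mul_jacobi_weight`) — i.e.
  `m̂_k(λ) ∼ 2π/k` (`jacobi_weight_isEquivalent`), uniformly the value `∫_G m_k dν = 2π/(k−2)` of `λ = 0`
  would suggest; at `λ = 1` this is `k · C_k² → 2π` for the Abel constants `C_k = √π Γ((k−1)/2)/Γ(k/2)`
  (`tendsto_mul_abel_const_sq`);
* for the lowest-weight coefficient of the weight-`k` model, **`k² ∫_G |⟨π_k(g) 1, 1⟩_k| φ_λ dν → 2π²`**
  (`tendsto_sq_mul_integral_norm_matrixCoeff`);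
* `k ↦ m̂_k(λ)` is differentiable (hence continuous) on the ray `k > max(1, λ, 2 − λ)`
  (`differentiableAt_jacobi_weight`, `differentiableOn_jacobi_weight`, `continuousOn_jacobi_weight`),
  the companion in the weight of `T5SU11JacobiContinuity` in the parameter.

Nothing is claimed about (N).

Blind lane: Mathlib + the HodgeRepro2 prefix only; no sorry; axioms ⊆ {propext, Classical.choice,
Quot.sound}.
-/

namespace Summit.Ventures.HodgeRepro2.T5SU11JacobiWeightAsymptotic

open MeasureTheory MeasureTheory.Measure Metric Set Filter Topology Asymptotics
open T5SU11Unimodular T5SU11Fibration T5SU11Cartan T5HaarCircle T5BergmanCoefficient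
  T5SU11FibrationHaar T5SU11SphericalFunction T5SU11SphericalSymmetry T5SU11JacobiIwasawa
  T5SU11JacobiTransform T5SU11XiTransform T5SU11JacobiDuplication T5SU11WendelGammaRatio
  T5SU11JacobiContinuity T5BergmanPairing T5BergmanMatrixCoeff T5BergmanIntegrableSharp
  T5SU11CoeffSphericalTransform
open scoped Real

/-! ### Differentiability of the symmetric closed form in the weight -/

/-- `k ↦ Γ((k − λ)/2)` is differentiable at every `k > λ`. -/
lemma differentiableAt_Gamma_sub_div_two_weight {k lam : ℝ} (h : lam < k) :
    DifferentiableAt ℝ (fun k => Real.Gamma ((k - lam) / 2)) k := by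
  have h1 : DifferentiableAt ℝ Real.Gamma ((fun k : ℝ => (k - lam) / 2) k) :=
    differentiableAt_Gamma_of_pos (by simp only; linarith)
  have hf : DifferentiableAt ℝ (fun k : ℝ => (k - lam) / 2) k := by fun_prop
  exact DifferentiableAt.comp (g := Real.Gamma) k h1 hf

/-- `k ↦ Γ((k + λ)/2 − 1)` is differentiable at every `k > 2 − λ`. -/
lemma differentiableAt_Gamma_add_div_two_sub_one_weight {k lam : ℝ} (h : 2 < k + lam) :
    DifferentiableAt ℝ (fun k => Real.Gamma ((k + lam) / 2 - 1)) k := by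
  have h1 : DifferentiableAt ℝ Real.Gamma ((fun k : ℝ => (k + lam) / 2 - 1) k) :=
    differentiableAt_Gamma_of_pos (by simp only; linarith)
  have hf : DifferentiableAt ℝ (fun k : ℝ => (k + lam) / 2 - 1) k := by fun_prop
  exact DifferentiableAt.comp (g := Real.Gamma) k h1 hf

/-- `k ↦ Γ(k/2)` is differentiable at every `k > 0`. -/
lemma differentiableAt_Gamma_div_two {k : ℝ} (h : 0 < k) :
    DifferentiableAt ℝ (fun k : ℝ => Real.Gamma (k / 2)) k := by
  have h1 : DifferentiableAt ℝ Real.Gamma ((fun k : ℝ => k / 2) k) :=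
    differentiableAt_Gamma_of_pos (by simp only; linarith)
  have hf : DifferentiableAt ℝ (fun k : ℝ => k / 2) k := by fun_prop
  exact DifferentiableAt.comp (g := Real.Gamma) k h1 hf

/-- The symmetric closed form is differentiable in `k` on the ray. -/
lemma differentiableAt_jacobi_weight_formula {k lam : ℝ} (hk : 1 < k) (h1 : lam < k)
    (h2 : 2 < k + lam) :
    DifferentiableAt ℝ (fun k => π * Real.Gamma ((k - lam) / 2) * Real.Gamma ((k + lam) / 2 - 1)
      / Real.Gamma (k / 2) ^ 2) k :=
  (((differentiableAt_const _).mul (differentiableAt_Gamma_sub_div_two_weight h1)).mul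
    (differentiableAt_Gamma_add_div_two_sub_one_weight h2)).div
    ((differentiableAt_Gamma_div_two (by linarith)).pow 2)
    (pow_ne_zero 2 (Real.Gamma_pos_of_pos (by linarith)).ne')

section measure

variable [MeasurableSpace Circle] [BorelSpace Circle]

/-- On the open ray the transform coincides with the symmetric closed form (as functions of `k`). -/
lemma jacobi_weight_eventuallyEq_formula {k lam : ℝ} (hk : 1 < k) (h1 : lam < k) (h2 : 2 < k + lam) :
    (fun k => ∫ g, (1 - ‖orbit g‖ ^ 2) ^ (k / 2) * sph lam g ∂(nu haarCircle))
      =ᶠ[𝓝 k] fun k => π * Real.Gamma ((k - lam) / 2) * Real.Gamma ((k + lam) / 2 - 1)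
        / Real.Gamma (k / 2) ^ 2 := by
  filter_upwards [Ioi_mem_nhds (show max 1 (max lam (2 - lam)) < k by
    rw [max_lt_iff, max_lt_iff]; exact ⟨hk, h1, by linarith⟩)] with k' hk'
  rw [mem_Ioi, max_lt_iff, max_lt_iff] at hk'
  exact integral_orbit_rpow_mul_sph_dup hk'.1 hk'.2.1 (by linarith [hk'.2.2])

/-- **`k ↦ m̂_k(λ)` is differentiable at every point of the ray `k > max(1, λ, 2 − λ)`.** -/
theorem differentiableAt_jacobi_weight {k lam : ℝ} (hk : 1 < k) (h1 : lam < k) (h2 : 2 < k + lam) :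
    DifferentiableAt ℝ
      (fun k => ∫ g, (1 - ‖orbit g‖ ^ 2) ^ (k / 2) * sph lam g ∂(nu haarCircle)) k :=
  (differentiableAt_jacobi_weight_formula hk h1 h2).congr_of_eventuallyEq
    (jacobi_weight_eventuallyEq_formula hk h1 h2)

/-- `k ↦ m̂_k(λ)` is differentiable on the ray. -/
theorem differentiableOn_jacobi_weight (lam : ℝ) :
    DifferentiableOn ℝ
      (fun k => ∫ g, (1 - ‖orbit g‖ ^ 2) ^ (k / 2) * sph lam g ∂(nu haarCircle))
      (Ioi (max 1 (max lam (2 - lam)))) := by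
  intro k hk
  rw [mem_Ioi, max_lt_iff, max_lt_iff] at hk
  exact (differentiableAt_jacobi_weight hk.1 hk.2.1 (by linarith [hk.2.2])).differentiableWithinAt

/-- `k ↦ m̂_k(λ)` is continuous on the ray. -/
theorem continuousOn_jacobi_weight (lam : ℝ) :
    ContinuousOn
      (fun k => ∫ g, (1 - ‖orbit g‖ ^ 2) ^ (k / 2) * sph lam g ∂(nu haarCircle))
      (Ioi (max 1 (max lam (2 - lam)))) :=
  (differentiableOn_jacobi_weight lam).continuousOn

/-! ### The sharp asymptotic `k · m̂_k(λ) → 2π` -/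

/-- **`k · m̂_k(λ) → 2π` as `k → ∞`**, for every `λ`. -/
theorem tendsto_mul_jacobi_weight (lam : ℝ) :
    Tendsto (fun k : ℝ => k * ∫ g, (1 - ‖orbit g‖ ^ 2) ^ (k / 2) * sph lam g ∂(nu haarCircle))
      atTop (𝓝 (2 * π)) := by
  have h := ((tendsto_Gamma_ratio_mul (-lam / 2) (lam / 2 - 1)).comp
    (tendsto_id.atTop_div_const two_pos)).const_mul (2 * π)
  rw [mul_one] at h
  refine h.congr' ?_
  filter_upwards [eventually_gt_atTop (max 1 (max lam (2 - lam)))] with k hk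
  rw [max_lt_iff, max_lt_iff] at hk
  dsimp only [Function.comp_apply, id]
  rw [integral_orbit_rpow_mul_sph_dup hk.1 hk.2.1 (by linarith [hk.2.2]),
    show (k - lam) / 2 = k / 2 + -lam / 2 by ring,
    show (k + lam) / 2 - 1 = k / 2 + (lam / 2 - 1) by ring,
    show -lam / 2 + (lam / 2 - 1) = -1 by ring, Real.rpow_neg_one]
  have hk0 : 0 < k := by linarith
  have hG : Real.Gamma (k / 2) ≠ 0 := (Real.Gamma_pos_of_pos (by linarith)).ne'
  field_simp

/-- **`m̂_k(λ) ∼ 2π/k`** (`Asymptotics.IsEquivalent`). -/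
theorem jacobi_weight_isEquivalent (lam : ℝ) :
    (fun k : ℝ => ∫ g, (1 - ‖orbit g‖ ^ 2) ^ (k / 2) * sph lam g ∂(nu haarCircle))
      ~[atTop] fun k : ℝ => 2 * π / k := by
  refine isEquivalent_of_tendsto_one ?_
  have h := (tendsto_mul_jacobi_weight lam).div_const (2 * π)
  rw [div_self (by positivity : (2 * π) ≠ 0)] at h
  refine h.congr' ?_
  filter_upwards [eventually_gt_atTop (0 : ℝ)] with k hk
  simp only [Pi.div_apply]
  field_simp

/-- **`k · C_k² → 2π`** for the Abel constants `C_k = √π Γ((k−1)/2)/Γ(k/2)` (the case `λ = 1`: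
`m̂_k(1) = C_k²`, `T5SU11XiTransform.integral_orbit_rpow_mul_sph_one_eq_sq`). -/
theorem tendsto_mul_abel_const_sq :
    Tendsto (fun k : ℝ => k * (√π * Real.Gamma ((k - 1) / 2) / Real.Gamma (k / 2)) ^ 2) atTop
      (𝓝 (2 * π)) := by
  refine (tendsto_mul_jacobi_weight 1).congr' ?_
  filter_upwards [eventually_gt_atTop (1 : ℝ)] with k hk
  rw [integral_orbit_rpow_mul_sph_one_eq_sq hk]

/-- **`k² ∫_G |⟨π_k(g) 1, 1⟩_k| φ_λ dν → 2π²`** as the weight `k → ∞` (through the integers). -/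
theorem tendsto_sq_mul_integral_norm_matrixCoeff (lam : ℝ) :
    Tendsto (fun k : ℕ => (k : ℝ) ^ 2
      * ∫ g, ‖matrixCoeff k lowest lowest g‖ * sph lam g ∂(nu haarCircle)) atTop (𝓝 (2 * π ^ 2)) := by
  have h1 : Tendsto (fun k : ℕ => (k : ℝ)
      * ∫ g, (1 - ‖orbit g‖ ^ 2) ^ ((k : ℝ) / 2) * sph lam g ∂(nu haarCircle)) atTop (𝓝 (2 * π)) :=
    (tendsto_mul_jacobi_weight lam).comp tendsto_natCast_atTop_atTop
  have h2 : Tendsto (fun k : ℕ => (k : ℝ) / ((k : ℝ) + -1)) atTop (𝓝 1) :=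
    tendsto_natCast_div_add_atTop (-1)
  have h := (h2.mul h1).const_mul π
  rw [one_mul, show π * (2 * π) = 2 * π ^ 2 by ring] at h
  refine h.congr' ?_
  filter_upwards [eventually_ge_atTop 2] with k hk
  have hk1 : (1 : ℝ) < k := by exact_mod_cast (by omega : 1 < k)
  simp_rw [norm_matrixCoeff_lowest_lowest_eq_orbit_rpow k hk, mul_assoc]
  rw [integral_const_mul]
  have h3 : (k : ℝ) - 1 ≠ 0 := by
    intro h0
    linarith
  have h4 : (k : ℝ) + -1 ≠ 0 := by
    intro h0
    linarith
  field_simp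
  ring

end measure

end Summit.Ventures.HodgeRepro2.T5SU11JacobiWeightAsymptotic
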